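import Summits.ResolutionOfSingularities.ResolutionOfSingularities.Theorems.FrobeniusClosingSteerVertexShiftRigidityA
import HarnessLib

/-!
# Crux `Steer` (stmt-ResolutionOfSingularities-16345), chain W4.1 — §11 DESCENT TRIO FILE 1B: **`vertexShiftRigidity_holds :
# VertexShiftRigidity`** (uniqueness of the dissolving vector at an integral vertex, characteristic `2`, odd degree)

OURS (campaign `res-hironaka`, rung L ★L-G4, slot W4.1; a kernel proof of the route's own word `VertexDescent.VertexShiftRigidity` of
FILE 0 `…Theorems.FrobeniusClosingSteerVertexDescentWords` (p549379, res-L0-w41-idea-1 g10's `VertexDescent-idea-1-g10.lean`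
5662ba702317d2c3 VERBATIM); it replaces the role of no printed item and is NOT a statement of the manuscript under review
[claim: Hironaka2017, status: under-review]; AI-produced, AI review is weaker than expert review). Seat res-D-repro-2 g9 on custody
res-plan-2 IDLE POOL DEAL #30 (4) and res-L0-w41-plan-1 RULING 189c. Mathematics: res-L0-w41-idea-1 g10, memo `CANONICAL-CLEANING-g10.md`
2ea9717796005c14 §11 (RIGIDITY LEMMA and its SUBLEMMA); audits res-L0-w41-tri-2 v25-lite / res-L0-w41-tri-1 v6.22 R-VD (`Odd d`,
`NotAlmostPower` load-bearing). Def-free; imports FILE 1A only; no Theses import; nothing here is a route item or a registration.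

PROOF (memo §11, both cleaning classes at once — `IsRemovable e m` implies even-even in `(Z, W)` for either class). Let `c, c'` dissolve
`F`, `t := c + c'` (characteristic `2`), `Ψ := F|_{M=0}`, `G := shift_{c'} F`, `N := G − G|_{M=0} = G − Ψ`. Then `shift_t G = shift_c F`;
every monomial of `N` involves `M` and is even-even, hence so does every monomial of `shift_t N` (FILE 1A `vertexShift_removable`);
`D := shift_t Ψ − Ψ = (shift_t G − G) − (shift_t N − N)` has `D|_{M=0} = 0`, so all its monomials involve `M` and are even-even;
in characteristic `2` this gives `∂_Z D = ∂_W D = 0`, i.e. `∂_Z Ψ`, `∂_W Ψ` are fixed by `shift_t`. TRANSLATION SUBLEMMA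
(`exists_eq_C_mul_linePow_of_vertexShift_eq`): an `M`-free form of degree `e` fixed by `shift_t`, `t ≠ 0`, is `α·ℓ_t^e` with
`ℓ_t = t₂ Z + t₁ W` — axis case `t = (τ, 0)` by a fixed-point computation with the substitutions `Z ↦ 0`, `Z ↦ τM`, `M ↦ τ⁻¹Z`
(`aeval_killZ_eq_self_of_vertexShift_eq`, `eq_C_mul_X_one_pow`), general `t` by conjugating with `W ↦ t₁W + t₂Z` (`t₁ ≠ 0`) or the
swap `Z ↔ W` (`t₁ = 0`). Euler's identity for the homogeneous `Ψ` (`d` odd, characteristic `2`: `d·Ψ = Ψ`, and `∂_M Ψ = 0`) then gives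
`Ψ = Z·∂_Z Ψ + W·∂_W Ψ = ℓ_t^{d−1}(αZ + βW)`, contradicting `NotAlmostPower F d` unless `t = 0`, i.e. `c = c'`. [folklore]
-/

-- `Summit.<S>.<S>.…` duplicates the summit name by design (single-problem summit).
set_option linter.dupNamespace false
set_option autoImplicit false

namespace Summit.ResolutionOfSingularities.ResolutionOfSingularities.Theorems.SwitchingDichotomy.VertexDescent

open MvPolynomial

section Sublemma

variable {κ : Type} [Field κ]

/-- THE TRANSLATION SUBLEMMA, axis case: an `M`-free polynomial fixed by the vertex shift `Z ↦ Z + τM` (`τ ≠ 0`, `M` a free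
variable — the formal, all-multiples form of translation invariance) does not involve `Z`: it is fixed by `Z ↦ 0`.
(Pure algebra-map bookkeeping: with `ε = [Z ↦ 0]`, `ρ = ε ∘ shift = [Z ↦ τM]` and `μ = [M ↦ τ⁻¹Z]` one has `μ ∘ ρ = μ`,
`μ` and `μ ∘ ε` fix `M`-free polynomials resp. act on them like `ε`, whence `g = μ(ρ g) = μ(ε g) = ε g`.) [folklore] -/
theorem aeval_killZ_eq_self_of_vertexShift_eq {τ : κ} (hτ : τ ≠ 0) (g : MvPolynomial (Fin 3) κ)
    (hg0 : aeval ![X 0, X 1, (0 : MvPolynomial (Fin 3) κ)] g = g) (hfix : vertexShift τ 0 g = g) :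
    aeval ![(0 : MvPolynomial (Fin 3) κ), X 1, X 2] g = g := by
  -- the four algebra maps and their relations on generators
  have hρ : (aeval ![(0 : MvPolynomial (Fin 3) κ), X 1, X 2]).comp (vertexShift τ 0) =
      aeval ![C τ * X 2, X 1, (X 2 : MvPolynomial (Fin 3) κ)] := by
    refine MvPolynomial.algHom_ext fun i => ?_
    fin_cases i <;> simp
  have hμρ : (aeval ![X 0, X 1, C τ⁻¹ * (X 0 : MvPolynomial (Fin 3) κ)]).comp
      (aeval ![C τ * X 2, X 1, (X 2 : MvPolynomial (Fin 3) κ)]) =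
      aeval ![X 0, X 1, C τ⁻¹ * (X 0 : MvPolynomial (Fin 3) κ)] := by
    refine MvPolynomial.algHom_ext fun i => ?_
    fin_cases i <;> simp
    rw [← mul_assoc, ← map_mul, mul_inv_cancel₀ hτ, map_one, one_mul]
  have hμ0 : (aeval ![X 0, X 1, C τ⁻¹ * (X 0 : MvPolynomial (Fin 3) κ)]).comp
      (aeval ![X 0, X 1, (0 : MvPolynomial (Fin 3) κ)]) = aeval ![X 0, X 1, (0 : MvPolynomial (Fin 3) κ)] := by
    refine MvPolynomial.algHom_ext fun i => ?_
    fin_cases i <;> simp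
  have hμε0 : ((aeval ![X 0, X 1, C τ⁻¹ * (X 0 : MvPolynomial (Fin 3) κ)]).comp
      (aeval ![(0 : MvPolynomial (Fin 3) κ), X 1, X 2])).comp (aeval ![X 0, X 1, (0 : MvPolynomial (Fin 3) κ)]) =
      (aeval ![(0 : MvPolynomial (Fin 3) κ), X 1, X 2]).comp (aeval ![X 0, X 1, (0 : MvPolynomial (Fin 3) κ)]) := by
    refine MvPolynomial.algHom_ext fun i => ?_
    fin_cases i <;> simp
  -- the chain `g = μ(ρ g) = μ(ε g) = ε g`
  have h1 : aeval ![X 0, X 1, C τ⁻¹ * (X 0 : MvPolynomial (Fin 3) κ)] g = g := by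
    conv_lhs => rw [← hg0]
    rw [← AlgHom.comp_apply, hμ0, hg0]
  have h2 : aeval ![C τ * X 2, X 1, (X 2 : MvPolynomial (Fin 3) κ)] g =
      aeval ![(0 : MvPolynomial (Fin 3) κ), X 1, X 2] g := by
    rw [← hρ, AlgHom.comp_apply, hfix]
  have h3 : aeval ![X 0, X 1, C τ⁻¹ * (X 0 : MvPolynomial (Fin 3) κ)]
      (aeval ![(0 : MvPolynomial (Fin 3) κ), X 1, X 2] g) = aeval ![(0 : MvPolynomial (Fin 3) κ), X 1, X 2] g := by
    conv_lhs => rw [← hg0]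
    rw [← AlgHom.comp_apply, ← AlgHom.comp_apply, hμε0, AlgHom.comp_apply, hg0]
  calc aeval ![(0 : MvPolynomial (Fin 3) κ), X 1, X 2] g
      = aeval ![X 0, X 1, C τ⁻¹ * (X 0 : MvPolynomial (Fin 3) κ)] (aeval ![(0 : MvPolynomial (Fin 3) κ), X 1, X 2] g) :=
        h3.symm
    _ = aeval ![X 0, X 1, C τ⁻¹ * (X 0 : MvPolynomial (Fin 3) κ)] (aeval ![C τ * X 2, X 1, (X 2 : MvPolynomial (Fin 3) κ)] g) := by
        rw [h2]
    _ = aeval ![X 0, X 1, C τ⁻¹ * (X 0 : MvPolynomial (Fin 3) κ)] g := by rw [← AlgHom.comp_apply, hμρ]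
    _ = g := h1

/-- A homogeneous polynomial of degree `e` involving only the variable `W` (fixed by `M ↦ 0` and by `Z ↦ 0`) is `α·W^e`. [folklore] -/
theorem eq_C_mul_X_one_pow {e : ℕ} (g : MvPolynomial (Fin 3) κ)
    (hg0 : aeval ![X 0, X 1, (0 : MvPolynomial (Fin 3) κ)] g = g)
    (hgZ : aeval ![(0 : MvPolynomial (Fin 3) κ), X 1, X 2] g = g) (hge : g.IsHomogeneous e) :
    g = C (coeff (Finsupp.single 1 e) g) * X 1 ^ e := by
  classical
  have hcomp : (aeval ![(0 : MvPolynomial (Fin 3) κ), X 1, X 2]).comp (aeval ![X 0, X 1, (0 : MvPolynomial (Fin 3) κ)]) =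
      aeval ![(0 : MvPolynomial (Fin 3) κ), X 1, 0] := by
    refine MvPolynomial.algHom_ext fun i => ?_
    fin_cases i <;> simp
  have hg : g = aeval ![(0 : MvPolynomial (Fin 3) κ), X 1, 0] g := by
    conv_lhs => rw [← hgZ, ← hg0]
    rw [← AlgHom.comp_apply, hcomp]
  -- expand over the support of `g`
  have hterm : ∀ n : Fin 3 →₀ ℕ, aeval ![(0 : MvPolynomial (Fin 3) κ), X 1, 0] (monomial n (coeff n g)) =
      C (coeff n g) * ((0 : MvPolynomial (Fin 3) κ) ^ n 0 * X 1 ^ n 1 * (0 : MvPolynomial (Fin 3) κ) ^ n 2) := by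
    intro n
    rw [aeval_monomial, Finsupp.prod_fintype _ _ (fun i => by simp), Fin.prod_univ_three]
    simp only [Matrix.cons_val_zero, Matrix.cons_val_one, Matrix.cons_val, algebraMap_eq]
  have hmain : aeval ![(0 : MvPolynomial (Fin 3) κ), X 1, 0] g = C (coeff (Finsupp.single 1 e) g) * X 1 ^ e := by
    nth_rewrite 1 [g.as_sum]
    rw [map_sum, Finset.sum_eq_single (Finsupp.single 1 e)]
    · rw [hterm]; simp
    · intro n hn hne
      rw [hterm]
      have hdeg : n 0 + n 1 + n 2 = e := by
        have h' : n.degree = e := by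
          have h := hge (mem_support_iff.mp hn)
          rw [Finsupp.degree_eq_weight_one]; exact h
        rw [Finsupp.degree_eq_sum, Fin.sum_univ_three] at h'
        exact h'
      by_cases h0 : n 0 = 0
      · by_cases h2 : n 2 = 0
        · exfalso; apply hne
          have hn1 : n 1 = e := by omega
          ext i
          fin_cases i <;> simp [h0, h2, hn1]
        · rw [zero_pow h2]; simp
      · rw [zero_pow h0]; simp
    · intro hnot
      rw [hterm, notMem_support_iff.mp hnot, map_zero, zero_mul]
  exact hg.trans hmain

/-- THE TRANSLATION SUBLEMMA (characteristic `2`): an `M`-free form of degree `e` fixed by the vertex shift by `t ≠ 0` is a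
scalar multiple of `ℓ_t^e`, `ℓ_t = t₂ Z + t₁ W` (conjugate the shift to the axis case `Z ↦ Z + t₁M` by `W ↦ t₁W + t₂Z`
when `t₁ ≠ 0`, by the swap `Z ↔ W` when `t₁ = 0`). [folklore] -/
theorem exists_eq_C_mul_linePow_of_vertexShift_eq [CharP κ 2] {t₁ t₂ : κ} (ht : t₁ ≠ 0 ∨ t₂ ≠ 0) {e : ℕ}
    (g : MvPolynomial (Fin 3) κ) (hg0 : aeval ![X 0, X 1, (0 : MvPolynomial (Fin 3) κ)] g = g)
    (hge : g.IsHomogeneous e) (hfix : vertexShift t₁ t₂ g = g) :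
    ∃ α : κ, g = C α * (C t₂ * X 0 + C t₁ * X 1) ^ e := by
  classical
  haveI : CharP (MvPolynomial (Fin 3) κ) 2 := inferInstance
  by_cases h1 : t₁ = 0
  · -- swap case: `t = (0, t₂)`, `t₂ ≠ 0`
    have h2 : t₂ ≠ 0 := ht.resolve_left (not_not.mpr h1)
    subst h1
    have hσσ : (aeval ![X 1, X 0, (X 2 : MvPolynomial (Fin 3) κ)]).comp (aeval ![X 1, X 0, (X 2 : MvPolynomial (Fin 3) κ)]) =
        AlgHom.id κ _ := by
      refine MvPolynomial.algHom_ext fun i => ?_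
      fin_cases i <;> simp
    have hconj : (aeval ![X 1, X 0, (X 2 : MvPolynomial (Fin 3) κ)]).comp ((vertexShift 0 t₂).comp
        (aeval ![X 1, X 0, (X 2 : MvPolynomial (Fin 3) κ)])) = vertexShift t₂ 0 := by
      refine MvPolynomial.algHom_ext fun i => ?_
      fin_cases i <;> simp
    have hc0 : (aeval ![X 0, X 1, (0 : MvPolynomial (Fin 3) κ)]).comp (aeval ![X 1, X 0, (X 2 : MvPolynomial (Fin 3) κ)]) =
        (aeval ![X 1, X 0, (X 2 : MvPolynomial (Fin 3) κ)]).comp (aeval ![X 0, X 1, (0 : MvPolynomial (Fin 3) κ)]) := by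
      refine MvPolynomial.algHom_ext fun i => ?_
      fin_cases i <;> simp
    have hg'0 : aeval ![X 0, X 1, (0 : MvPolynomial (Fin 3) κ)] (aeval ![X 1, X 0, (X 2 : MvPolynomial (Fin 3) κ)] g) =
        aeval ![X 1, X 0, (X 2 : MvPolynomial (Fin 3) κ)] g := by
      rw [← AlgHom.comp_apply, hc0, AlgHom.comp_apply, hg0]
    have hg'fix : vertexShift t₂ 0 (aeval ![X 1, X 0, (X 2 : MvPolynomial (Fin 3) κ)] g) =
        aeval ![X 1, X 0, (X 2 : MvPolynomial (Fin 3) κ)] g := by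
      have h := congrArg (fun φ : MvPolynomial (Fin 3) κ →ₐ[κ] MvPolynomial (Fin 3) κ =>
        φ (aeval ![X 1, X 0, (X 2 : MvPolynomial (Fin 3) κ)] g)) hconj
      simp only [AlgHom.comp_apply] at h
      have hss : aeval ![X 1, X 0, (X 2 : MvPolynomial (Fin 3) κ)] (aeval ![X 1, X 0, (X 2 : MvPolynomial (Fin 3) κ)] g) = g := by
        rw [← AlgHom.comp_apply, hσσ, AlgHom.id_apply]
      rw [← h, hss, hfix]
    have hg'e : (aeval ![X 1, X 0, (X 2 : MvPolynomial (Fin 3) κ)] g).IsHomogeneous e := by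
      have h := hge.aeval ![X 1, X 0, (X 2 : MvPolynomial (Fin 3) κ)] (n := 1) (fun i => by
        fin_cases i <;> simpa using isHomogeneous_X κ _)
      rw [one_mul] at h
      exact h
    have hZ := aeval_killZ_eq_self_of_vertexShift_eq h2 _ hg'0 hg'fix
    obtain ⟨a, ha⟩ : ∃ a : κ, aeval ![X 1, X 0, (X 2 : MvPolynomial (Fin 3) κ)] g = C a * X 1 ^ e :=
      ⟨_, eq_C_mul_X_one_pow _ hg'0 hZ hg'e⟩
    refine ⟨a * (t₂⁻¹) ^ e, ?_⟩
    have hback : g = aeval ![X 1, X 0, (X 2 : MvPolynomial (Fin 3) κ)] (aeval ![X 1, X 0, (X 2 : MvPolynomial (Fin 3) κ)] g) := by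
      rw [← AlgHom.comp_apply, hσσ, AlgHom.id_apply]
    have hX1 : aeval ![X 1, X 0, (X 2 : MvPolynomial (Fin 3) κ)] (X 1 : MvPolynomial (Fin 3) κ) = X 0 := by simp
    have hs : a * (t₂⁻¹) ^ e * t₂ ^ e = a := by
      rw [mul_assoc, ← mul_pow, inv_mul_cancel₀ h2, one_pow, mul_one]
    rw [hback, ha, map_mul, map_pow, algHom_C, hX1, map_zero, zero_mul, add_zero, mul_pow, ← map_pow, ← mul_assoc,
      ← map_mul, hs]
    simp only [MvPolynomial.algebraMap_eq]
  · -- generic case: `t₁ ≠ 0`, conjugate by `W ↦ t₁ W + t₂ Z`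
    have hx : (C t₂ * X 0 + C t₂ * X 0 : MvPolynomial (Fin 3) κ) = 0 := CharTwo.add_self_eq_zero _
    have hm : (C t₁ * (C t₂ * X 2) + C t₂ * (C t₁ * X 2) : MvPolynomial (Fin 3) κ) = 0 := by
      rw [← mul_assoc, ← mul_assoc, ← map_mul, ← map_mul, mul_comm t₂ t₁]; exact CharTwo.add_self_eq_zero _
    have hi : (C t₁⁻¹ * C t₁ : MvPolynomial (Fin 3) κ) = 1 := by rw [← map_mul, inv_mul_cancel₀ h1, map_one]
    have hi' : (C t₁ * C t₁⁻¹ : MvPolynomial (Fin 3) κ) = 1 := by rw [← map_mul, mul_inv_cancel₀ h1, map_one]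
    -- images of the generators under the two substitutions and the shifts (literal indices)
    have eθ0 : aeval ![X 0, C t₁ * X 1 + C t₂ * X 0, (X 2 : MvPolynomial (Fin 3) κ)] (X 0 : MvPolynomial (Fin 3) κ) = X 0 := by
      simp
    have eθ1 : aeval ![X 0, C t₁ * X 1 + C t₂ * X 0, (X 2 : MvPolynomial (Fin 3) κ)] (X 1 : MvPolynomial (Fin 3) κ) =
        C t₁ * X 1 + C t₂ * X 0 := by simp
    have eθ2 : aeval ![X 0, C t₁ * X 1 + C t₂ * X 0, (X 2 : MvPolynomial (Fin 3) κ)] (X 2 : MvPolynomial (Fin 3) κ) = X 2 := by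
      simp
    have eη0 : aeval ![X 0, C t₁⁻¹ * (X 1 + C t₂ * X 0), (X 2 : MvPolynomial (Fin 3) κ)] (X 0 : MvPolynomial (Fin 3) κ) =
        X 0 := by simp
    have eη1 : aeval ![X 0, C t₁⁻¹ * (X 1 + C t₂ * X 0), (X 2 : MvPolynomial (Fin 3) κ)] (X 1 : MvPolynomial (Fin 3) κ) =
        C t₁⁻¹ * (X 1 + C t₂ * X 0) := by simp
    have eη2 : aeval ![X 0, C t₁⁻¹ * (X 1 + C t₂ * X 0), (X 2 : MvPolynomial (Fin 3) κ)] (X 2 : MvPolynomial (Fin 3) κ) =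
        X 2 := by simp
    -- the three conjugation identities, generator `X 1` first (literal index), then `algHom_ext`
    have k1 : ((aeval ![X 0, C t₁ * X 1 + C t₂ * X 0, (X 2 : MvPolynomial (Fin 3) κ)]).comp
        (aeval ![X 0, C t₁⁻¹ * (X 1 + C t₂ * X 0), (X 2 : MvPolynomial (Fin 3) κ)])) (X 1) =
        (AlgHom.id κ (MvPolynomial (Fin 3) κ)) (X 1) := by
      rw [AlgHom.comp_apply, AlgHom.id_apply, eη1]
      simp only [map_mul, map_add, algHom_C, MvPolynomial.algebraMap_eq, eθ1, eθ0]
      linear_combination (X 1) * hi + (C t₁⁻¹) * hx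
    have hθθ' : (aeval ![X 0, C t₁ * X 1 + C t₂ * X 0, (X 2 : MvPolynomial (Fin 3) κ)]).comp
        (aeval ![X 0, C t₁⁻¹ * (X 1 + C t₂ * X 0), (X 2 : MvPolynomial (Fin 3) κ)]) = AlgHom.id κ _ := by
      refine MvPolynomial.algHom_ext fun i => ?_
      fin_cases i
      · simp
      · exact k1
      · simp
    have k2 : ((aeval ![X 0, C t₁⁻¹ * (X 1 + C t₂ * X 0), (X 2 : MvPolynomial (Fin 3) κ)]).comp
        (aeval ![X 0, C t₁ * X 1 + C t₂ * X 0, (X 2 : MvPolynomial (Fin 3) κ)])) (X 1) =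
        (AlgHom.id κ (MvPolynomial (Fin 3) κ)) (X 1) := by
      rw [AlgHom.comp_apply, AlgHom.id_apply, eθ1]
      simp only [map_mul, map_add, algHom_C, MvPolynomial.algebraMap_eq, eη1, eη0]
      linear_combination (X 1 + C t₂ * X 0) * hi' + hx
    have hθ'θ : (aeval ![X 0, C t₁⁻¹ * (X 1 + C t₂ * X 0), (X 2 : MvPolynomial (Fin 3) κ)]).comp
        (aeval ![X 0, C t₁ * X 1 + C t₂ * X 0, (X 2 : MvPolynomial (Fin 3) κ)]) = AlgHom.id κ _ := by
      refine MvPolynomial.algHom_ext fun i => ?_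
      fin_cases i
      · simp
      · exact k2
      · simp
    have k3 : ((aeval ![X 0, C t₁⁻¹ * (X 1 + C t₂ * X 0), (X 2 : MvPolynomial (Fin 3) κ)]).comp
        ((vertexShift t₁ t₂).comp (aeval ![X 0, C t₁ * X 1 + C t₂ * X 0, (X 2 : MvPolynomial (Fin 3) κ)]))) (X 1) =
        vertexShift t₁ 0 (X 1) := by
      rw [AlgHom.comp_apply, AlgHom.comp_apply, eθ1]
      simp only [map_add, map_mul, algHom_C, MvPolynomial.algebraMap_eq, vertexShift_X_one, vertexShift_X_zero, eη1, eη0,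
        eη2, map_zero, zero_mul, add_zero]
      linear_combination (X 1 + C t₂ * X 0) * hi' + hx + hm
    have hconj : (aeval ![X 0, C t₁⁻¹ * (X 1 + C t₂ * X 0), (X 2 : MvPolynomial (Fin 3) κ)]).comp
        ((vertexShift t₁ t₂).comp (aeval ![X 0, C t₁ * X 1 + C t₂ * X 0, (X 2 : MvPolynomial (Fin 3) κ)])) =
        vertexShift t₁ 0 := by
      refine MvPolynomial.algHom_ext fun i => ?_
      fin_cases i
      · simp
      · exact k3
      · simp
    have hc0 : (aeval ![X 0, X 1, (0 : MvPolynomial (Fin 3) κ)]).comp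
        (aeval ![X 0, C t₁⁻¹ * (X 1 + C t₂ * X 0), (X 2 : MvPolynomial (Fin 3) κ)]) =
        (aeval ![X 0, C t₁⁻¹ * (X 1 + C t₂ * X 0), (X 2 : MvPolynomial (Fin 3) κ)]).comp
        (aeval ![X 0, X 1, (0 : MvPolynomial (Fin 3) κ)]) := by
      refine MvPolynomial.algHom_ext fun i => ?_
      fin_cases i <;> simp
    have hg'0 : aeval ![X 0, X 1, (0 : MvPolynomial (Fin 3) κ)]
        (aeval ![X 0, C t₁⁻¹ * (X 1 + C t₂ * X 0), (X 2 : MvPolynomial (Fin 3) κ)] g) =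
        aeval ![X 0, C t₁⁻¹ * (X 1 + C t₂ * X 0), (X 2 : MvPolynomial (Fin 3) κ)] g := by
      rw [← AlgHom.comp_apply, hc0, AlgHom.comp_apply, hg0]
    have hg'fix : vertexShift t₁ 0 (aeval ![X 0, C t₁⁻¹ * (X 1 + C t₂ * X 0), (X 2 : MvPolynomial (Fin 3) κ)] g) =
        aeval ![X 0, C t₁⁻¹ * (X 1 + C t₂ * X 0), (X 2 : MvPolynomial (Fin 3) κ)] g := by
      have h := congrArg (fun φ : MvPolynomial (Fin 3) κ →ₐ[κ] MvPolynomial (Fin 3) κ =>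
        φ (aeval ![X 0, C t₁⁻¹ * (X 1 + C t₂ * X 0), (X 2 : MvPolynomial (Fin 3) κ)] g)) hconj
      simp only [AlgHom.comp_apply] at h
      have hss : aeval ![X 0, C t₁ * X 1 + C t₂ * X 0, (X 2 : MvPolynomial (Fin 3) κ)]
          (aeval ![X 0, C t₁⁻¹ * (X 1 + C t₂ * X 0), (X 2 : MvPolynomial (Fin 3) κ)] g) = g := by
        rw [← AlgHom.comp_apply, hθθ', AlgHom.id_apply]
      rw [← h, hss, hfix]
    have hg'e : (aeval ![X 0, C t₁⁻¹ * (X 1 + C t₂ * X 0), (X 2 : MvPolynomial (Fin 3) κ)] g).IsHomogeneous e := by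
      have h := hge.aeval ![X 0, C t₁⁻¹ * (X 1 + C t₂ * X 0), (X 2 : MvPolynomial (Fin 3) κ)] (n := 1) (fun i => by
        fin_cases i
        · simpa using isHomogeneous_X κ _
        · simpa using ((isHomogeneous_X κ 1).add (isHomogeneous_C_mul_X t₂ 0)).C_mul t₁⁻¹
        · simpa using isHomogeneous_X κ _)
      rw [one_mul] at h
      exact h
    have hZ := aeval_killZ_eq_self_of_vertexShift_eq h1 _ hg'0 hg'fix
    obtain ⟨a, ha⟩ : ∃ a : κ,
        aeval ![X 0, C t₁⁻¹ * (X 1 + C t₂ * X 0), (X 2 : MvPolynomial (Fin 3) κ)] g = C a * X 1 ^ e :=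
      ⟨_, eq_C_mul_X_one_pow _ hg'0 hZ hg'e⟩
    refine ⟨a, ?_⟩
    have hback : g = aeval ![X 0, C t₁ * X 1 + C t₂ * X 0, (X 2 : MvPolynomial (Fin 3) κ)]
        (aeval ![X 0, C t₁⁻¹ * (X 1 + C t₂ * X 0), (X 2 : MvPolynomial (Fin 3) κ)] g) := by
      rw [← AlgHom.comp_apply, hθθ', AlgHom.id_apply]
    rw [hback, ha, map_mul, map_pow, algHom_C, eθ1, add_comm (C t₁ * X 1)]
    simp only [MvPolynomial.algebraMap_eq]

end Sublemma

section Main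

/-- **VERTEX-SHIFT RIGIDITY** (`VertexShiftRigidity`, res-L0-w41-idea-1 g10 §11): over a field of characteristic `2`, for a form `F`
of odd degree `d ≥ 3` whose cone `Ψ = F(Z, W, 0)` is not an almost-power, two dissolving vectors coincide. Proof (memo §11, both
cleaning classes at once): with `t = c + c'`, `G = shift_{c'} F`, `N = G − Ψ` (the `M`-part of `G`: monomials involving `M`, all
even-even by `Dissolves`), `shift_t G = shift_c F` and the stability of the removable span give that every monomial of
`D = Ψ(Z + t₁M, W + t₂M) − Ψ` involves `M` and is even-even in `(Z, W)`; hence `∂_Z D = ∂_W D = 0`, i.e. `∂_Z Ψ`, `∂_W Ψ` are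
fixed by the shift; for `t ≠ 0` the translation sublemma makes them multiples of `ℓ_t^{d−1}`, and Euler's identity (`d` odd,
characteristic `2`: `d·Ψ = Ψ`) gives `Ψ = ℓ_t^{d−1}(αZ + βW)` — an almost-power. So `t = 0`. [folklore] -/
theorem vertexShiftRigidity_holds : VertexShiftRigidity := by
  classical
  intro κ _ _ d evenClass F c₁ c₂ c₁' c₂' hodd hd hF hNAP hD hD'
  haveI : CharP (MvPolynomial (Fin 3) κ) 2 := inferInstance
  -- in characteristic 2, `c = c'` iff `t := c + c' = 0`
  by_contra hne
  have ht : c₁ + c₁' ≠ 0 ∨ c₂ + c₂' ≠ 0 := by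
    by_cases h1 : c₁ + c₁' = 0
    · by_cases h2 : c₂ + c₂' = 0
      · refine absurd ⟨?_, ?_⟩ hne
        · rwa [← CharTwo.sub_eq_add, sub_eq_zero] at h1
        · rwa [← CharTwo.sub_eq_add, sub_eq_zero] at h2
      · exact Or.inr h2
    · exact Or.inl h1
  apply hNAP
  set t₁ := c₁ + c₁' with ht₁
  set t₂ := c₂ + c₂' with ht₂
  -- the cone `Ψ`, the shifted form `G = shift_{c'} F` and its `M`-part `N`
  set Ψ : MvPolynomial (Fin 3) κ := aeval ![X 0, X 1, (0 : MvPolynomial (Fin 3) κ)] F with hΨ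
  set G : MvPolynomial (Fin 3) κ := vertexShift c₁' c₂' F with hG
  set N : MvPolynomial (Fin 3) κ := G - aeval ![X 0, X 1, (0 : MvPolynomial (Fin 3) κ)] G with hN
  have hGG : vertexShift t₁ t₂ G = vertexShift c₁ c₂ F := by
    have h1 : t₁ + c₁' = c₁ := by rw [ht₁, add_assoc, CharTwo.add_self_eq_zero, add_zero]
    have h2 : t₂ + c₂' = c₂ := by rw [ht₂, add_assoc, CharTwo.add_self_eq_zero, add_zero]
    rw [hG, vertexShift_vertexShift, h1, h2]
  have hconeG : aeval ![X 0, X 1, (0 : MvPolynomial (Fin 3) κ)] G = Ψ := by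
    rw [hG, ← AlgHom.comp_apply, cone_comp_vertexShift]
  -- `Dissolves` at `c` and at `c'`: every monomial involving `M` is even-even
  have hE : ∀ m ∈ (vertexShift t₁ t₂ G).support, 1 ≤ m 2 → Even (m 0) ∧ Even (m 1) := by
    rw [hGG]; exact fun m hm h => (hD m hm h).2
  have hE' : ∀ m ∈ G.support, 1 ≤ m 2 → Even (m 0) ∧ Even (m 1) := fun m hm h => (hD' m hm h).2
  -- the `M`-part `N` of `G` lies in the removable span, and so does its shift
  have hNsupp : ∀ m ∈ N.support, 1 ≤ m 2 ∧ Even (m 0) ∧ Even (m 1) := by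
    intro m hm
    rw [mem_support_iff, hN, coeff_sub_cone] at hm
    by_cases h2 : m 2 = 0
    · exact absurd (if_pos h2) hm
    · rw [if_neg h2] at hm
      have h1 : 1 ≤ m 2 := Nat.one_le_iff_ne_zero.mpr h2
      exact ⟨h1, hE' m (mem_support_iff.mpr hm) h1⟩
  have hsN := vertexShift_removable t₁ t₂ N hNsupp
  -- the discrepancy `D = shift_t Ψ − Ψ`
  have hDeq : vertexShift t₁ t₂ Ψ - Ψ = (vertexShift t₁ t₂ G - G) - (vertexShift t₁ t₂ N - N) := by
    rw [hN, map_sub, hconeG]; ring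
  have hDM : ∀ m ∈ (vertexShift t₁ t₂ Ψ - Ψ).support, 1 ≤ m 2 := by
    intro m hm
    by_contra h
    have h0 : m 2 = 0 := by omega
    have hc : coeff m (aeval ![X 0, X 1, (0 : MvPolynomial (Fin 3) κ)] (vertexShift t₁ t₂ Ψ - Ψ)) = coeff m (vertexShift t₁ t₂ Ψ - Ψ) := by
      rw [coeff_cone, if_pos h0]
    have hzero : aeval ![X 0, X 1, (0 : MvPolynomial (Fin 3) κ)] (vertexShift t₁ t₂ Ψ - Ψ) = 0 := by
      rw [map_sub, ← AlgHom.comp_apply, cone_comp_vertexShift, hΨ, ← AlgHom.comp_apply, cone_comp_cone, sub_self]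
    rw [hzero, coeff_zero] at hc
    exact (mem_support_iff.mp hm) hc.symm
  have hDev : ∀ m ∈ (vertexShift t₁ t₂ Ψ - Ψ).support, Even (m 0) ∧ Even (m 1) := by
    intro m hm
    have h1 := hDM m hm
    rw [hDeq] at hm
    have key : ∀ m ∈ ((vertexShift t₁ t₂ G - G) - (vertexShift t₁ t₂ N - N)).support,
        1 ≤ m 2 → Even (m 0) ∧ Even (m 1) :=
      forall_support_sub (P := fun m => 1 ≤ m 2 → Even (m 0) ∧ Even (m 1))
        (forall_support_sub (P := fun m => 1 ≤ m 2 → Even (m 0) ∧ Even (m 1)) hE hE')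
        (forall_support_sub (P := fun m => 1 ≤ m 2 → Even (m 0) ∧ Even (m 1))
          (fun m hm _ => (hsN m hm).2) (fun m hm _ => (hNsupp m hm).2))
    exact key m hm h1
  -- hence `∂_Z D = ∂_W D = 0`: the partial derivatives of `Ψ` are fixed by the shift
  have hD0 : pderiv 0 (vertexShift t₁ t₂ Ψ - Ψ) = 0 :=
    pderiv_eq_zero_of_forall_even 0 _ fun m hm => (hDev m hm).1
  have hD1 : pderiv 1 (vertexShift t₁ t₂ Ψ - Ψ) = 0 :=
    pderiv_eq_zero_of_forall_even 1 _ fun m hm => (hDev m hm).2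
  have hfix0 : vertexShift t₁ t₂ (pderiv 0 Ψ) = pderiv 0 Ψ := by
    rw [map_sub, pderiv_zero_vertexShift, sub_eq_zero] at hD0; exact hD0
  have hfix1 : vertexShift t₁ t₂ (pderiv 1 Ψ) = pderiv 1 Ψ := by
    rw [map_sub, pderiv_one_vertexShift, sub_eq_zero] at hD1; exact hD1
  -- `Ψ` and its partials: homogeneous, `M`-free
  have hΨhom : Ψ.IsHomogeneous d := by
    have h := hF.aeval ![X 0, X 1, (0 : MvPolynomial (Fin 3) κ)] (n := 1) (fun i => by
      fin_cases i
      · simpa using isHomogeneous_X κ _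
      · simpa using isHomogeneous_X κ _
      · simpa using isHomogeneous_zero (Fin 3) κ 1)
    rw [one_mul] at h; exact h
  have hΨ0 : aeval ![X 0, X 1, (0 : MvPolynomial (Fin 3) κ)] Ψ = Ψ := by
    rw [hΨ, ← AlgHom.comp_apply, cone_comp_cone]
  have hd0 : aeval ![X 0, X 1, (0 : MvPolynomial (Fin 3) κ)] (pderiv 0 Ψ) = pderiv 0 Ψ := by
    rw [← pderiv_zero_cone, hΨ0]
  have hd1 : aeval ![X 0, X 1, (0 : MvPolynomial (Fin 3) κ)] (pderiv 1 Ψ) = pderiv 1 Ψ := by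
    rw [← pderiv_one_cone, hΨ0]
  obtain ⟨α, hα⟩ := exists_eq_C_mul_linePow_of_vertexShift_eq ht (pderiv 0 Ψ) hd0 hΨhom.pderiv hfix0
  obtain ⟨β, hβ⟩ := exists_eq_C_mul_linePow_of_vertexShift_eq ht (pderiv 1 Ψ) hd1 hΨhom.pderiv hfix1
  -- Euler in characteristic 2 for odd `d`: `Ψ = Z Ψ_Z + W Ψ_W`
  have hd2 : pderiv 2 Ψ = 0 := by
    refine pderiv_eq_zero_of_forall_even 2 Ψ fun m hm => ?_
    rw [hΨ] at hm
    rw [apply_two_eq_zero_of_mem_support_cone F m hm]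
    exact ⟨0, rfl⟩
  have heuler := hΨhom.sum_X_mul_pderiv
  rw [Fin.sum_univ_three, hd2, mul_zero, add_zero] at heuler
  have hdΨ : d • Ψ = Ψ := by
    obtain ⟨k, rfl⟩ := hodd
    rw [add_smul, one_smul, mul_comm, mul_smul, two_smul, CharTwo.add_self_eq_zero, smul_zero, zero_add]
  refine ⟨t₁, t₂, C α * X 0 + C β * X 1, ht, ?_⟩
  calc Ψ = X 0 * pderiv 0 Ψ + X 1 * pderiv 1 Ψ := by rw [heuler, hdΨ]
    _ = (C t₂ * X 0 + C t₁ * X 1) ^ (d - 1) * (C α * X 0 + C β * X 1) := by rw [hα, hβ]; ring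

end Main

end Summit.ResolutionOfSingularities.ResolutionOfSingularities.Theorems.SwitchingDichotomy.VertexDescent
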